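import Literature.NumberTheory.EllipticCurves.RootNumber
import HarnessLib

/-!
# Local root numbers are signs (proof)

Sibling proof file of `Literature.NumberTheory.EllipticCurves.RootNumber` (D-0014: the statement
file keeps the named fact `def … : Prop`; its discharge lives here, sorry-free, in its own file so
that concurrent discharges of the topic do not overwrite each other). This file discharges

* `WeierstrassCurve.localRootNumber_sq_eq_one` by
  `WeierstrassCurve.localRootNumber_sq_eq_one_holds`: for `W` over the fraction field `K` of a DVR
  `R` with *finite* residue field `k`, away from additive reduction in residue characteristic `≤ 3`
  (hypothesis `¬ (W.minimal R).HasAdditiveReduction R ∨ 3 < ringChar k`), the local root number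
  `W.localRootNumber R` (Rohrlich's case list) satisfies `(W.localRootNumber R) ^ 2 = 1`.

## Proof architecture

In print the statement is immediate: `W(E/K) = ε(σ'_E, ψ, dx) / |ε(σ'_E, ψ, dx)| ∈ {±1}` for the
(symplectic, self-dual) Weil–Deligne representation `σ'_E` of `E`, and Rohrlich's case list
(Compositio 87 (1993), Prop. 2, for `E / ℚ_p`, `p ≥ 5`; Compositio 100 (1996), Thm. 2, residue
characteristic `≥ 5`; restated as Helfgott, arXiv:math/0408141, Prop. 6.1, pp. 20–21, and
Desjardins, JTNB 32 (2020), Prop. 4.1, p. 6) lists the values `1`, `±1` (multiplicative),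
`(−1 | k)`, `(−2 | k)`, `(−3 | k)` — quadratic residue symbols of units, hence signs.

For the vendored *definition* `WeierstrassCurve.localRootNumber` (an explicit nested `if`) the
proof walks the branches:

1. good / split multiplicative / non-split multiplicative: the values `1`, `−1`, `1` square to `1`;
2. the documented junk branch (additive, `char k ∈ {2, 3}`, value `0`) is unreachable under the
   hypothesis: either `3 < char k`, or the minimal model is not additive, and then — not being good
   or multiplicative either, by the enclosing branches — it contradicts Mathlib's trichotomy
   `WeierstrassCurve.hasGoodReduction_or_hasMultiplicativeReduction_or_hasAdditiveReduction`
   for the minimal equation `W.minimal R`;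
3. past that branch `char k ≠ 2`, so `q = #k` is odd (`FiniteField.odd_card_of_char_ne_two`), and
   the remaining values `χ₄(q) = (−1 | k)`, `χ₈'(q) = (−2 | k)` (`ZMod.χ₄_nat_eq_if_mod_four`,
   `ZMod.χ₈'_nat_eq_if_mod_eight`) and `[q ≡ 1 (3)] ? 1 : −1 = (−3 | k)` are `±1`.

## References

* D. E. Rohrlich, *Variation of the root number in families of elliptic curves*, Compositio Math.
  87 (1993), 119–151, Prop. 2.
* D. E. Rohrlich, *Galois theory, elliptic curves, and root numbers*, Compositio Math. 100 (1996),
  311–349, Thm. 2.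
* H. A. Helfgott, *On the behaviour of root numbers in families of elliptic curves*,
  arXiv:math/0408141 (2004), Prop. 6.1 (pp. 20–21).
* J. Desjardins, *Root number of twists of an elliptic curve*, J. Théor. Nombres Bordeaux 32
  (2020), 73–101, Prop. 4.1 (p. 6 of arXiv:1801.05262).
-/

namespace WeierstrassCurve

variable (R : Type*) [CommRing R] [IsDomain R] [IsDiscreteValuationRing R]
  {K : Type*} [Field K] [Algebra R K] [IsFractionRing R K] (W : WeierstrassCurve K)

/-- **Discharge** of the named fact `WeierstrassCurve.localRootNumber_sq_eq_one`: for a finite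
residue field `k` and away from additive reduction in residue characteristic `≤ 3`, the local root
number is a sign, `(W.localRootNumber R) ^ 2 = 1`. Rohrlich's case list (Compositio 87 (1993),
Prop. 2 for `E / ℚ_p`, `p ≥ 5`; Compositio 100 (1996), Thm. 2 in residue characteristic `≥ 5`;
restated in Helfgott 2004, Prop. 6.1 and Desjardins 2020, Prop. 4.1) takes the values `1`, `±1`,
`(−1 | k)`, `(−2 | k)`, `(−3 | k)`, all in `{±1}`; for the vendored nested-`if` definition the junk
branch (`char k ∈ {2, 3}`, value `0`) is excluded by the hypothesis together with Mathlib's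
trichotomy of reduction types of the minimal model, and `χ₄(q)`, `χ₈'(q)` are `±1` because
`q = #k` is odd once `char k ≠ 2`.
[cite: Rohrlich1993Compositio, Prop. 2] [cite: Rohrlich1996Compositio, Thm. 2]
[cite: Helfgott2004RootNumbers, Prop. 6.1 (pp. 20–21)] [cite: Desjardins2020, Prop. 4.1] -/
theorem localRootNumber_sq_eq_one_holds : W.localRootNumber_sq_eq_one R := by
  intro _ h
  -- past the junk branch `char k ∈ {2, 3}` the residue field has odd cardinality `q`
  have hq : ¬ (ringChar (IsLocalRing.ResidueField R) = 2 ∨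
      ringChar (IsLocalRing.ResidueField R) = 3) →
      Nat.card (IsLocalRing.ResidueField R) % 2 = 1 := fun hℓ ↦ by
    letI := Fintype.ofFinite (IsLocalRing.ResidueField R)
    rw [Nat.card_eq_fintype_card]
    exact FiniteField.odd_card_of_char_ne_two fun h2 ↦ hℓ (Or.inl h2)
  -- the quadratic characters `χ₄`, `χ₈'` take the values `±1` on odd naturals
  have hχ₄ : ∀ {n : ℕ}, n % 2 = 1 → ZMod.χ₄ n ^ 2 = 1 := fun hn ↦ by
    rw [ZMod.χ₄_nat_eq_if_mod_four]
    split_ifs <;> simp_all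
  have hχ₈ : ∀ {n : ℕ}, n % 2 = 1 → ZMod.χ₈' n ^ 2 = 1 := fun hn ↦ by
    rw [ZMod.χ₈'_nat_eq_if_mod_eight]
    split_ifs <;> simp_all
  unfold localRootNumber
  split_ifs
  · rfl
  · rfl
  · rfl
  · -- the junk branch is unreachable under `h`
    exfalso
    rcases h with h | h
    · rcases hasGoodReduction_or_hasMultiplicativeReduction_or_hasAdditiveReduction R
          (W := W.minimal R) with h' | h' | h'
      · exact ‹¬ (W.minimal R).HasGoodReduction R› h'
      · exact ‹¬ (W.minimal R).HasMultiplicativeReduction R› h'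
      · exact h h'
    · have hℓ : ringChar (IsLocalRing.ResidueField R) = 2 ∨
          ringChar (IsLocalRing.ResidueField R) = 3 := ‹_›
      omega
  · exact hχ₄ (hq ‹_›)
  · exact hχ₄ (hq ‹_›)
  · rfl
  · rfl
  · exact hχ₈ (hq ‹_›)

end WeierstrassCurve
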